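import Mathlib
import HarnessLib
import Summits.AtomisticToContinuum.Crystallization.Theorems.PricedLinkCensusSoftFourRingsRigData

/-!
# Soft four-rings, metric half by certified numerics (12): the FCC certificate stream passes the check

Route `PricedLinkCensus`, sub-problem `Crystallization`, item `SoftFourRings`
(stmt-AtomisticToContinuum-14234).  `checkAll fccModel fccCells = true`, evaluated by `native_decide` (the check replays about 2000 LP dual certificates in exact integer arithmetic at scale `2^60`; about 80 s).
-/

namespace Summit.AtomisticToContinuum.Crystallization.Theorems

namespace Rig

/-- **The FCC certificate stream passes the check** (both charts covered, every cell certified). -/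
theorem fcc_checkAll : checkAll fccModel fccCells = true := by native_decide

end Rig

end Summit.AtomisticToContinuum.Crystallization.Theorems
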